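import Literature.NumberTheory.Sieve.SmoothArcPrincipal
import Literature.NumberTheory.Sieve.SmoothCharacterSumBound
import Literature.NumberTheory.Sieve.SmoothCharacterDecayGoodLevel
import Literature.NumberTheory.Sieve.SmoothEndgameMinor
import Mathlib.NumberTheory.DirichletCharacter.Orthogonality
import Mathlib.NumberTheory.DirichletCharacter.Bounds
import Mathlib.RingTheory.RootsOfUnity.AlgebraicallyClosed
import Mathlib.Analysis.Complex.Polynomial.Basic
import HarnessLib

/-!
# The smooth-weighted exponential sum on an arc `a/q + λ/x`

Topic `Literature/NumberTheory/Sieve`; a PROVED file toward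
`Literature.NumberTheory.DiophantineGeometry.XYZUpperHalf` ([Harper2016, Cor. 1], §5 with the
smooth weight `w(v) = v²(1−v)²`). For `θ = a/q + λ/X` the weighted sum
`S_w(θ; X) = ∑_{n ∈ S(X,y)} w(n/X) e(nθ)` is the arc sum `∑ e(an/q) W_λ(n/X)` of
`SmoothArcCharacters` (`smoothWeightSum_eq_arcSum`). Expanding `e(an/q)` into Dirichlet
characters (`arcSum_eq_sum_char`):

* the principal character contributes `e₀^{−α} 𝓜 Ŵ_λ(α) G_α(q)` up to
  `(ε + e^{−66}) H_α(q) e₀^{−α}𝓜/(1+|λ|)` at every scale `X = x/e₀` with `e₀ q ≤ (log x)^{100}`, on the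
  fixed line `Re s = α(x, y)` (`principalPart_estimate_scaled`, the scaled form of
  `SmoothArcs.principalPart_estimate`);
* at a good level `y` (`GoodLevel δ₀ θ y`) every non-principal character mod `q ≤ y^θ` contributes at
  most `q^{5/2} (x^α ζ(α,y)/2π) ν₀` with
  `ν₀ = 2T₀ e^{−D₀/5} + 2π C_Λ/T₀²`, `T₀ = y^{θ/2}/40`,
  `D₀ = (4 log y)⁻¹ ∫_{3y^{1−θ/2}}^{y} v^{−α} dv` (`norm_nonprincipalPart_le`, from
  `norm_char_smoothSum_le` and `decaySum_lower_bound_of_goodLevel`).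

Together: `arc_estimate`.

## References

* A. J. Harper, Compositio Math. 152 (2016), §2.2, §5 and Appendix [Harper2016].
* H. L. Montgomery, R. C. Vaughan, Acta Arith. 27 (1975), §5–6 [MontgomeryVaughanActa1975].
-/

noncomputable section

open Finset Real Complex
open scoped FourierTransform ArithmeticFunction.Moebius

namespace Literature.NumberTheory.Sieve

namespace Endgame

open MontgomeryVaughan1975 TwistedWeight SmoothArcs

/-! ### `S_w(a/q + λ/X; X)` is the arc sum -/

/-- `S_w(a/q + λ/X; X) = ∑_{n ∈ S(X,y)} e(an/q) W_λ(n/X)`. [cite: Harper2016, §5] -/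
theorem smoothWeightSum_eq_arcSum {X : ℝ} (hX : 0 < X) (y q a : ℕ) (lam : ℝ) :
    smoothWeightSum X y ((a : ℝ) / q + lam / X) = arcSum X y q a lam := by
  unfold smoothWeightSum arcSum
  refine Finset.sum_congr rfl fun n hn => ?_
  rw [Nat.mem_smoothNumbersUpTo] at hn
  have hn1 : 1 ≤ n := Nat.pos_of_ne_zero (Nat.ne_zero_of_mem_smoothNumbers hn.2)
  have hnX : (n : ℝ) ≤ X := le_trans (by exact_mod_cast hn.1) (Nat.floor_le hX.le)
  have hv : (n : ℝ) / X ∈ Set.Ioc (0 : ℝ) 1 :=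
    ⟨by positivity, by rw [div_le_one hX]; exact hnX⟩
  rw [twistWeight_of_mem hv]
  have he : (𝐞 ((n : ℝ) * ((a : ℝ) / q + lam / X)) : ℂ) =
      (𝐞 ((a * n : ℝ) / q) : ℂ) * (𝐞 (lam * ((n : ℝ) / X)) : ℂ) := by
    have : (n : ℝ) * ((a : ℝ) / q + lam / X) = (a * n : ℝ) / q + lam * ((n : ℝ) / X) := by ring
    rw [this, AddChar.map_add_eq_mul, Circle.coe_mul]
  rw [he, wt]
  push_cast
  ring

/-! ### The principal part at the scales `x/e₀` -/

set_option maxHeartbeats 800000 in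
/-- **Principal part at scale `x/e₀`.** For `x ≥ x₀(ε)`, `(log x)^4 ≤ y ≤ exp((log x)^{1/5})`,
`1 ≤ Λ`, `Λ⁸ ≤ y`, `e₀ ≥ 1`, a `y`-smooth `q` with `e₀ q ≤ (log x)^{100}` and `|λ| ≤ Λ`:
`‖φ(q)⁻¹ T_{χ₀}(x/e₀) − e₀^{−α}𝓜 Ŵ_λ(α) G_α(q)‖ ≤ (ε + e^{−66}) H_α(q) e₀^{−α}𝓜/(1+|λ|)`
(`α = α(x,y)`, `𝓜 = x^α ζ(α,y)/√(2πφ₂(α,y))`). [cite: Harper2016, §2.2, §5] -/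
theorem principalPart_estimate_scaled {ε : ℝ} (hε : 0 < ε) :
    ∃ x₀ : ℝ, ∀ (x : ℝ) (y : ℕ), x₀ ≤ x → Real.log x ^ 4 ≤ y → Real.log y ≤ Real.log x ^ (1 / 5 : ℝ) →
      ∀ Λ : ℝ, 1 ≤ Λ → Λ ^ 8 ≤ (y : ℝ) → ∀ e₀ : ℕ, 1 ≤ e₀ → ∀ (q : ℕ) [NeZero q], q ∈ Nat.smoothNumbers (y + 1) →
      ((e₀ * q : ℕ) : ℝ) ≤ Real.log x ^ 100 → ∀ lam : ℝ, |lam| ≤ Λ →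
      ‖((q.totient : ℂ))⁻¹ * charTwistSum (x / e₀) y (1 : DirichletCharacter ℂ q) lam -
          ((((e₀ : ℝ) ^ (-saddlePoint x y) * (x ^ saddlePoint x y * smoothZeta (saddlePoint x y) y /
              Real.sqrt (2 * Real.pi * saddlePhi₂ (saddlePoint x y) y)) : ℝ)) : ℂ) *
            twistMellin lam (saddlePoint x y) * (localG (saddlePoint x y) q : ℂ)‖ ≤
        (ε + Real.exp (-66)) * localH (saddlePoint x y) q *
          ((e₀ : ℝ) ^ (-saddlePoint x y) * (x ^ saddlePoint x y * smoothZeta (saddlePoint x y) y /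
            Real.sqrt (2 * Real.pi * saddlePhi₂ (saddlePoint x y) y))) / (1 + |lam|) := by
  obtain ⟨x₀, hmain⟩ := scaledSum_main_term hε
  refine ⟨max x₀ 1, fun x y hx hy4 hylog Λ hΛ1 hΛy e₀ he₀ q _ hqS hqL lam hlam => ?_⟩
  have hx₀ : x₀ ≤ x := le_trans (le_max_left _ _) hx
  have hx0 : 0 ≤ x := le_trans zero_le_one (le_trans (le_max_right _ _) hx)
  have hX0 : 0 ≤ x / e₀ := by positivity
  have hq : q ≠ 0 := NeZero.ne q
  have he₀0 : (0 : ℝ) < e₀ := by exact_mod_cast he₀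
  set α : ℝ := saddlePoint x y with hα
  set M₀ : ℝ := x ^ α * smoothZeta α y / Real.sqrt (2 * Real.pi * saddlePhi₂ α y) with hM₀
  set M : ℝ := (e₀ : ℝ) ^ (-α) * M₀ with hM
  rw [principalPart_eq_sum hX0 hqS lam]
  -- `localG`, `localH` as the same double sums
  have hG : ((localG α q : ℝ) : ℂ) = ∑ g ∈ q.divisors, ∑ d ∈ (q / g).divisors,
      ((μ (q / g) : ℂ) * (μ d : ℂ) / ((Nat.totient (q / g) : ℂ))) * ((((g * d : ℕ) : ℝ) ^ (-α) : ℝ) : ℂ) := by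
    unfold localG
    push_cast
    refine Finset.sum_congr rfl fun g _ => Finset.sum_congr rfl fun d _ => ?_
    ring
  -- the difference, term by term
  have hdiff : (∑ g ∈ q.divisors, ∑ d ∈ (q / g).divisors,
      ((μ (q / g) : ℂ) * (μ d : ℂ) / ((Nat.totient (q / g) : ℂ))) * smoothTwistSum (x / e₀ / ((g * d : ℕ) : ℝ)) y lam) -
      ((M : ℝ) : ℂ) * twistMellin lam α * (localG α q : ℂ) =
      ∑ g ∈ q.divisors, ∑ d ∈ (q / g).divisors,
        ((μ (q / g) : ℂ) * (μ d : ℂ) / ((Nat.totient (q / g) : ℂ))) *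
          (smoothTwistSum (x / e₀ / ((g * d : ℕ) : ℝ)) y lam -
            (((((g * d : ℕ) : ℝ) ^ (-α) * M : ℝ)) : ℂ) * twistMellin lam α) := by
    rw [hG, Finset.mul_sum]
    simp_rw [Finset.mul_sum, ← Finset.sum_sub_distrib]
    refine Finset.sum_congr rfl fun g _ => Finset.sum_congr rfl fun d _ => ?_
    push_cast; ring
  rw [hdiff]
  -- bound each term by `|μμ|/φ · (gd)^{-α} ε' M/(1+|λ|)`
  have hterm : ∀ g ∈ q.divisors, ∀ d ∈ (q / g).divisors,
      ‖((μ (q / g) : ℂ) * (μ d : ℂ) / ((Nat.totient (q / g) : ℂ))) *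
          (smoothTwistSum (x / e₀ / ((g * d : ℕ) : ℝ)) y lam -
            (((((g * d : ℕ) : ℝ) ^ (-α) * M : ℝ)) : ℂ) * twistMellin lam α)‖ ≤
        |(μ (q / g) : ℝ)| * |(μ d : ℝ)| * ((g * d : ℕ) : ℝ) ^ (-α) / ((q / g).totient : ℝ) *
          ((ε + Real.exp (-66)) * M / (1 + |lam|)) := by
    intro g hg d hd
    have hgq : g ∣ q := Nat.dvd_of_mem_divisors hg
    have hg0 : 0 < g := Nat.pos_of_mem_divisors hg
    have hd0 : 0 < d := Nat.pos_of_mem_divisors hd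
    have hdq : d ∣ q / g := Nat.dvd_of_mem_divisors hd
    have hgd1 : 1 ≤ g * d := Nat.one_le_iff_ne_zero.mpr (mul_ne_zero hg0.ne' hd0.ne')
    have hgdq : g * d ∣ q := by
      obtain ⟨k, hk⟩ := hdq
      have := Nat.div_mul_cancel hgq
      refine ⟨k, ?_⟩
      calc q = q / g * g := this.symm
        _ = d * k * g := by rw [hk]
        _ = g * d * k := by ring
    have he1 : 1 ≤ e₀ * (g * d) := Nat.one_le_iff_ne_zero.mpr (mul_ne_zero (by omega) (by omega))
    have heL : ((e₀ * (g * d) : ℕ) : ℝ) ≤ Real.log x ^ 100 := by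
      refine le_trans ?_ hqL
      exact_mod_cast Nat.mul_le_mul_left e₀ (Nat.le_of_dvd (Nat.pos_of_ne_zero hq) hgdq)
    have hS := hmain x y hx₀ hy4 hylog Λ hΛ1 hΛy (e₀ * (g * d)) he1 heL lam hlam
    rw [← hα] at hS
    -- rewrite the scale `x/e₀/(gd) = x/(e₀ g d)` and the constant `(e₀gd)^{-α} M₀ = (gd)^{-α} M`
    have hscale : x / e₀ / ((g * d : ℕ) : ℝ) = x / ((e₀ * (g * d) : ℕ) : ℝ) := by
      push_cast; rw [div_div]
    have hconst : ((e₀ * (g * d) : ℕ) : ℝ) ^ (-α) * M₀ = ((g * d : ℕ) : ℝ) ^ (-α) * M := by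
      rw [hM]; push_cast
      rw [Real.mul_rpow he₀0.le (by positivity)]; ring
    have hconst' : ((e₀ * (g * d) : ℕ) : ℝ) ^ (-α) * ((ε + Real.exp (-66)) * M₀ / (1 + |lam|)) =
        ((g * d : ℕ) : ℝ) ^ (-α) * ((ε + Real.exp (-66)) * M / (1 + |lam|)) := by
      rw [hM]; push_cast
      rw [Real.mul_rpow he₀0.le (by positivity)]; ring
    have hS' : ‖smoothTwistSum (x / e₀ / ((g * d : ℕ) : ℝ)) y lam - (((((g * d : ℕ) : ℝ) ^ (-α) * M : ℝ)) : ℂ) * twistMellin lam α‖ ≤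
        ((g * d : ℕ) : ℝ) ^ (-α) * ((ε + Real.exp (-66)) * M / (1 + |lam|)) := by
      rw [hscale, ← hconst, ← hconst']
      simpa [smoothTwistSum, hM₀] using hS
    rw [norm_mul]
    have hcoef : ‖(μ (q / g) : ℂ) * (μ d : ℂ) / ((Nat.totient (q / g) : ℂ))‖ =
        |(μ (q / g) : ℝ)| * |(μ d : ℝ)| / ((q / g).totient : ℝ) := by
      rw [norm_div, norm_mul, Complex.norm_intCast, Complex.norm_intCast, Complex.norm_natCast]
    rw [hcoef]
    have hφ0 : (0 : ℝ) ≤ ((q / g).totient : ℝ) := Nat.cast_nonneg _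
    calc |(μ (q / g) : ℝ)| * |(μ d : ℝ)| / ((q / g).totient : ℝ) *
          ‖smoothTwistSum (x / e₀ / ((g * d : ℕ) : ℝ)) y lam - (((((g * d : ℕ) : ℝ) ^ (-α) * M : ℝ)) : ℂ) * twistMellin lam α‖
        ≤ |(μ (q / g) : ℝ)| * |(μ d : ℝ)| / ((q / g).totient : ℝ) *
            (((g * d : ℕ) : ℝ) ^ (-α) * ((ε + Real.exp (-66)) * M / (1 + |lam|))) :=
          mul_le_mul_of_nonneg_left hS' (by positivity)
      _ = _ := by ring
  calc ‖∑ g ∈ q.divisors, ∑ d ∈ (q / g).divisors,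
        ((μ (q / g) : ℂ) * (μ d : ℂ) / ((Nat.totient (q / g) : ℂ))) *
          (smoothTwistSum (x / e₀ / ((g * d : ℕ) : ℝ)) y lam - (((((g * d : ℕ) : ℝ) ^ (-α) * M : ℝ)) : ℂ) * twistMellin lam α)‖
      ≤ ∑ g ∈ q.divisors, ∑ d ∈ (q / g).divisors,
          |(μ (q / g) : ℝ)| * |(μ d : ℝ)| * ((g * d : ℕ) : ℝ) ^ (-α) / ((q / g).totient : ℝ) *
            ((ε + Real.exp (-66)) * M / (1 + |lam|)) := by
        refine (norm_sum_le _ _).trans (Finset.sum_le_sum fun g hg => ?_)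
        exact (norm_sum_le _ _).trans (Finset.sum_le_sum fun d hd => hterm g hg d hd)
    _ = (ε + Real.exp (-66)) * localH α q * M / (1 + |lam|) := by
        rw [localH]
        simp_rw [← Finset.sum_mul]
        ring


/-! ### The non-principal characters at a good level -/

/-- There are `φ(q)` Dirichlet characters mod `q` with values in `ℂ` (cf. the tree's
`GreenWalsh.card_dirichletCharacter`, in a file too heavy to import here). [folklore] -/
private theorem card_univ_dirichletCharacter (q : ℕ) [NeZero q] :
    (Finset.univ : Finset (DirichletCharacter ℂ q)).card = q.totient := by
  rw [Finset.card_univ, ← Nat.card_eq_fintype_card]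
  exact DirichletCharacter.card_eq_totient_of_hasEnoughRootsOfUnity ℂ q

/-- The decay parameter `ν(λ) = 2T₀ e^{−D₀/5} + 2π C_λ/T₀²` of the non-principal characters
(`T₀ = y^{θ/2}/40`, `D₀ = (4 log y)⁻¹ ∫_{3y^{1−θ/2}}^{y} v^{−α} dv`,
`C_λ = 2 + 6(2π|λ|) + 6(2π|λ|)² + (2π|λ|)³`). [cite: Harper2016, Appendix] -/
def decayNu (y : ℕ) (θ α lam : ℝ) : ℝ :=
  2 * ((y : ℝ) ^ (θ / 2) / 40) *
      Real.exp (-((1 / (4 * Real.log y) * ∫ v in (3 * (y : ℝ) ^ (1 - θ / 2))..(y : ℝ), v ^ (-α)) / 5)) +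
    2 * π * (2 + 6 * (2 * π * |lam|) + 6 * (2 * π * |lam|) ^ 2 + (2 * π * |lam|) ^ 3) /
      ((y : ℝ) ^ (θ / 2) / 40) ^ 2

/-- `ν(λ)` is non-negative. [folklore] -/
theorem decayNu_nonneg (y : ℕ) (θ α lam : ℝ) : 0 ≤ decayNu y θ α lam := by
  unfold decayNu
  have := Real.pi_pos
  positivity

/-- `ν` is monotone in `|λ|`. [folklore] -/
theorem decayNu_mono {y : ℕ} {θ α lam Λ : ℝ} (h : |lam| ≤ Λ) : decayNu y θ α lam ≤ decayNu y θ α Λ := by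
  unfold decayNu
  have hπ := Real.pi_pos
  have h0 : 0 ≤ |lam| := abs_nonneg _
  have hΛ : |Λ| = Λ := abs_of_nonneg (h0.trans h)
  rw [hΛ]
  have h1 : 2 * π * |lam| ≤ 2 * π * Λ := by nlinarith
  have h2 : 0 ≤ 2 * π * |lam| := by positivity
  gcongr

/-- **A non-principal character on a sub-scale.** At a good level, for `ψ` primitive of conductor
`r ≠ 1`, `r ∣ q/g`, `q ≤ y^θ`, `3/5 ≤ α ≤ 1`:
`‖∑_{m ∈ S(X/g, y)} (ψ̄ mod q/g)(m) W_λ(m/(X/g))‖ ≤ (X^α ζ(α,y)/2π) ν(λ)`.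
[cite: Harper2016, Appendix] -/
theorem norm_induced_charSum_le {δ₀ θ : ℝ} {y : ℕ} (hgood : GoodLevel δ₀ θ y)
    (hδ₀ : 0 ≤ δ₀) (hδ₀' : δ₀ ≤ 1 / 20) (hθ0 : 0 < θ) (hθ : θ ≤ 1 / 5)
    (hy25 : 25 ≤ Real.log y) (hy40 : 40 * ((y : ℝ) ^ (1 - θ) + 1) ≤ (y : ℝ) ^ (1 - θ / 2))
    (hyq : (y : ℝ) ^ θ + 1 ≤ (y : ℝ) ^ (1 - θ / 2)) (hy3 : 3 * (y : ℝ) ^ (1 - θ / 2) ≤ y)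
    {α : ℝ} (hα : 3 / 5 ≤ α) (hα1 : α ≤ 1) {X : ℝ} (hX : 0 < X)
    {q : ℕ} [NeZero q] (hq : (q : ℝ) ≤ (y : ℝ) ^ θ) {g : ℕ} (hg : g ∈ q.divisors)
    {r : ℕ} [NeZero r] (hr1 : r ≠ 1) (hrg : r ∣ q / g) {ψ : DirichletCharacter ℂ r} (hψ : ψ.IsPrimitive) (lam : ℝ) :
    ‖∑ m ∈ Nat.smoothNumbersUpTo ⌊X / g⌋₊ (y + 1),
        (DirichletCharacter.changeLevel hrg ψ⁻¹) (m : ZMod (q / g)) * twistWeight lam (m / (X / g))‖ ≤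
      (X ^ α * smoothZeta α y / (2 * π)) * decayNu y θ α lam := by
  have hq0 : q ≠ 0 := NeZero.ne q
  obtain ⟨hgq, -⟩ := Nat.mem_divisors.mp hg
  have hg0 : 0 < g := Nat.pos_of_dvd_of_pos hgq (NeZero.pos q)
  haveI : NeZero (q / g) := ⟨(Nat.div_ne_zero_iff_of_dvd hgq).mpr ⟨hq0, hg0.ne'⟩⟩
  set χ' : DirichletCharacter ℂ (q / g) := DirichletCharacter.changeLevel hrg ψ⁻¹ with hχ'
  have hχ'1 : χ' ≠ 1 := by
    rw [hχ', Ne, DirichletCharacter.changeLevel_eq_one_iff, inv_eq_one]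
    intro h1
    have hc : ψ.conductor = 1 := by rw [h1]; exact DirichletCharacter.conductor_one
    rw [(DirichletCharacter.isPrimitive_def ψ).mp hψ] at hc
    exact hr1 hc
  have hq' : ((q / g : ℕ) : ℝ) ≤ (y : ℝ) ^ θ := le_trans (by exact_mod_cast Nat.div_le_self q g) hq
  have hlogy0 : 0 < Real.log y := by linarith
  have hy1 : (1 : ℝ) < y := by
    by_contra h0; push Not at h0
    have := Real.log_nonpos (Nat.cast_nonneg y) h0; linarith
  have hy0 : (0 : ℝ) < y := by linarith
  have hT₀ : 0 < (y : ℝ) ^ (θ / 2) / 40 := by positivity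
  have hα0 : 0 ≤ α := by linarith
  have hXg : 0 < X / g := div_pos hX (by exact_mod_cast hg0)
  have hD : ∀ t : ℝ, |t| ≤ (y : ℝ) ^ (θ / 2) / 40 →
      1 / (4 * Real.log y) * ∫ v in (3 * (y : ℝ) ^ (1 - θ / 2))..(y : ℝ), v ^ (-α) ≤
        ∑ p ∈ Nat.primesLE y, (p : ℝ) ^ (-α) * (1 - (χ' (p : ZMod (q / g)) * (p : ℂ) ^ (-((t : ℂ) * I))).re) :=
    fun t ht => decaySum_lower_bound_of_goodLevel hgood hδ₀ hδ₀' hθ0 hθ hy25 hy40 hyq hy3 χ' hχ'1 hq' hα0 hα1 ht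
  have h := norm_char_smoothSum_le hXg hα y χ' lam hT₀ hD
  refine h.trans ?_
  rw [decayNu]
  have hπ := Real.pi_pos
  have hζ : 0 < smoothZeta α y := smoothZeta_pos (by linarith)
  have hν : 0 ≤ 2 * ((y : ℝ) ^ (θ / 2) / 40) *
      Real.exp (-((1 / (4 * Real.log y) * ∫ v in (3 * (y : ℝ) ^ (1 - θ / 2))..(y : ℝ), v ^ (-α)) / 5)) +
      2 * π * (2 + 6 * (2 * π * |lam|) + 6 * (2 * π * |lam|) ^ 2 + (2 * π * |lam|) ^ 3) /
        ((y : ℝ) ^ (θ / 2) / 40) ^ 2 := by positivity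
  apply mul_le_mul_of_nonneg_right _ hν
  apply div_le_div_of_nonneg_right _ (by positivity)
  apply mul_le_mul_of_nonneg_right _ hζ.le
  exact Real.rpow_le_rpow hXg.le (div_le_self hX.le (by exact_mod_cast hg0)) hα0

/-- **The non-principal part of `T_χ`.** At a good level, for every non-principal `χ (mod q)`,
`q ≤ y^θ`, `3/5 ≤ α ≤ 1`, `X > 0`:
`‖T_χ(X)‖ ≤ φ(q) √q d(q) (X^α ζ(α,y)/2π) ν(λ)`. [cite: Harper2016, §5, Appendix] -/
theorem norm_charTwistSum_nonprincipal_le {δ₀ θ : ℝ} {y : ℕ} (hgood : GoodLevel δ₀ θ y)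
    (hδ₀ : 0 ≤ δ₀) (hδ₀' : δ₀ ≤ 1 / 20) (hθ0 : 0 < θ) (hθ : θ ≤ 1 / 5)
    (hy25 : 25 ≤ Real.log y) (hy40 : 40 * ((y : ℝ) ^ (1 - θ) + 1) ≤ (y : ℝ) ^ (1 - θ / 2))
    (hyq : (y : ℝ) ^ θ + 1 ≤ (y : ℝ) ^ (1 - θ / 2)) (hy3 : 3 * (y : ℝ) ^ (1 - θ / 2) ≤ y)
    {α : ℝ} (hα : 3 / 5 ≤ α) (hα1 : α ≤ 1) {X : ℝ} (hX : 0 < X)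
    {q : ℕ} [NeZero q] (hq : (q : ℝ) ≤ (y : ℝ) ^ θ) (χ : DirichletCharacter ℂ q) (hχ : χ ≠ 1) (lam : ℝ) :
    ‖charTwistSum X y χ lam‖ ≤
      (q.totient : ℝ) * Real.sqrt q * (q.divisors.card : ℝ) * ((X ^ α * smoothZeta α y / (2 * π)) * decayNu y θ α lam) := by
  have hq0 : q ≠ 0 := NeZero.ne q
  set r : ℕ := χ.conductor with hr
  haveI : NeZero r := ⟨χ.conductor_ne_zero⟩
  have hr1 : r ≠ 1 := fun h1 => hχ (DirichletCharacter.eq_one_iff_conductor_eq_one.mpr h1)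
  have hrq : r ∣ q := χ.conductor_dvd_level
  have hrle : r ≤ q := Nat.le_of_dvd (NeZero.pos q) hrq
  set ψ := χ.primitiveCharacter with hψ
  have hψp : ψ.IsPrimitive := χ.primitiveCharacter_isPrimitive
  have hχeq : DirichletCharacter.changeLevel hrq ψ = χ := DirichletCharacter.changeLevel_primitiveCharacter χ
  have h := norm_charTwistSum_changeLevel_le hX.le y hrq hψp lam
  rw [hχeq] at h
  refine h.trans ?_
  set B : ℝ := (X ^ α * smoothZeta α y / (2 * π)) * decayNu y θ α lam with hB
  have hπ := Real.pi_pos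
  have hζ : 0 < smoothZeta α y := smoothZeta_pos (by linarith)
  have hB0 : 0 ≤ B := by have := decayNu_nonneg y θ α lam; positivity
  have hsum : ∑ g ∈ q.divisors,
      (if hrg : r ∣ q / g then
        ‖∑ m ∈ Nat.smoothNumbersUpTo ⌊X / g⌋₊ (y + 1),
          (DirichletCharacter.changeLevel hrg ψ⁻¹) (m : ZMod (q / g)) * twistWeight lam (m / (X / g))‖
        else 0) ≤ (q.divisors.card : ℝ) * B := by
    calc _ ≤ ∑ g ∈ q.divisors, B := by
          refine Finset.sum_le_sum fun g hg => ?_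
          split_ifs with hrg
          · exact norm_induced_charSum_le hgood hδ₀ hδ₀' hθ0 hθ hy25 hy40 hyq hy3 hα hα1 hX hq hg hr1 hrg hψp lam
          · exact hB0
      _ = (q.divisors.card : ℝ) * B := by rw [Finset.sum_const, nsmul_eq_mul]
  have hsqrt : Real.sqrt r ≤ Real.sqrt q := Real.sqrt_le_sqrt (by exact_mod_cast hrle)
  calc (q.totient : ℝ) * Real.sqrt r * ∑ g ∈ q.divisors,
        (if hrg : r ∣ q / g then
          ‖∑ m ∈ Nat.smoothNumbersUpTo ⌊X / g⌋₊ (y + 1),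
            (DirichletCharacter.changeLevel hrg ψ⁻¹) (m : ZMod (q / g)) * twistWeight lam (m / (X / g))‖
          else 0)
      ≤ (q.totient : ℝ) * Real.sqrt q * ((q.divisors.card : ℝ) * B) := by
        apply mul_le_mul (mul_le_mul_of_nonneg_left hsqrt (Nat.cast_nonneg _)) hsum
          (Finset.sum_nonneg fun g _ => by split_ifs <;> first | exact norm_nonneg _ | exact le_rfl) (by positivity)
    _ = _ := by rw [hB]; ring

/-! ### The arc estimate -/

set_option maxHeartbeats 1600000 in
/-- **The smooth-weighted sum on the arc `a/q + λ/x` at the scales `x/e₀`.** For `x ≥ x₀(ε)`,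
`(log x)^4 ≤ y ≤ x`, `log y ≤ (log x)^{1/6}`, a good level `y` (large), `1 ≤ Λ`, `Λ⁸ ≤ y`, `Λ ≤ y^θ`,
`e₀ ≥ 1`, `q ≤ Λ` with `e₀ q ≤ (log x)^{100}`, `(a, q) = 1` and `|λ| ≤ Λ`:
`‖S(a/q+λ/x; x/e₀) − e₀^{−α}𝓜 Ŵ_λ(α) G_α(q)‖ ≤ (ε+e^{−66}) H_α(q) e₀^{−α}𝓜/(1+|λ|) + q²√q (x^αζ(α,y)/2π) ν(Λ)`.
[cite: Harper2016, §5] -/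
theorem arc_estimate {ε : ℝ} (hε : 0 < ε) {δ₀ θ : ℝ} (hδ₀ : 0 ≤ δ₀) (hδ₀' : δ₀ ≤ 1 / 20)
    (hθ0 : 0 < θ) (hθ : θ ≤ 1 / 5) :
    ∃ x₀ : ℝ, ∀ (x : ℝ) (y : ℕ), x₀ ≤ x → Real.log x ^ 4 ≤ y → (y : ℝ) ≤ x →
      Real.log y ≤ Real.log x ^ (1 / 6 : ℝ) → GoodLevel δ₀ θ y → 25 ≤ Real.log y →
      40 * ((y : ℝ) ^ (1 - θ) + 1) ≤ (y : ℝ) ^ (1 - θ / 2) → (y : ℝ) ^ θ + 1 ≤ (y : ℝ) ^ (1 - θ / 2) →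
      3 * (y : ℝ) ^ (1 - θ / 2) ≤ y →
      ∀ Λ : ℝ, 1 ≤ Λ → Λ ^ 8 ≤ (y : ℝ) → Λ ≤ (y : ℝ) ^ θ →
      ∀ e₀ : ℕ, 1 ≤ e₀ → ∀ (q : ℕ) [NeZero q], (q : ℝ) ≤ Λ → ((e₀ * q : ℕ) : ℝ) ≤ Real.log x ^ 100 →
      ∀ a : ℕ, a.Coprime q → ∀ lam : ℝ, |lam| ≤ Λ →
      ‖arcSum (x / e₀) y q a lam -
          ((((e₀ : ℝ) ^ (-saddlePoint x y) * (x ^ saddlePoint x y * smoothZeta (saddlePoint x y) y /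
              Real.sqrt (2 * Real.pi * saddlePhi₂ (saddlePoint x y) y)) : ℝ)) : ℂ) *
            twistMellin lam (saddlePoint x y) * (localG (saddlePoint x y) q : ℂ)‖ ≤
        (ε + Real.exp (-66)) * localH (saddlePoint x y) q *
            ((e₀ : ℝ) ^ (-saddlePoint x y) * (x ^ saddlePoint x y * smoothZeta (saddlePoint x y) y /
              Real.sqrt (2 * Real.pi * saddlePhi₂ (saddlePoint x y) y))) / (1 + |lam|) +
          (q : ℝ) ^ 2 * Real.sqrt q * ((x ^ saddlePoint x y * smoothZeta (saddlePoint x y) y / (2 * π)) *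
            decayNu y θ (saddlePoint x y) Λ) := by
  classical
  obtain ⟨x₀P, hP⟩ := principalPart_estimate_scaled hε
  obtain ⟨x₃₅, h35⟩ := three_fifths_le_saddlePoint
  obtain ⟨x₁, hlt1⟩ := saddlePoint_lt_one
  refine ⟨max (max x₀P x₃₅) (max x₁ (Real.exp 1)), fun x y hx hy4 hyx hylog hgood hy25 hy40 hyq hy3 Λ hΛ1 hΛ8 hΛθ
    e₀ he₀ q _ hqΛ hqL a ha lam hlam => ?_⟩
  have hx₀P : x₀P ≤ x := le_trans ((le_max_left _ _).trans (le_max_left _ _)) hx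
  have hx₃₅ : x₃₅ ≤ x := le_trans ((le_max_right _ _).trans (le_max_left _ _)) hx
  have hx₁ : x₁ ≤ x := le_trans ((le_max_left _ _).trans (le_max_right _ _)) hx
  have hxe : Real.exp 1 ≤ x := le_trans ((le_max_right _ _).trans (le_max_right _ _)) hx
  have hx0 : 0 < x := lt_of_lt_of_le (Real.exp_pos 1) hxe
  have hlogx1 : 1 ≤ Real.log x := by
    have := Real.log_le_log (Real.exp_pos 1) hxe; rwa [Real.log_exp] at this
  have hy3' : Real.log x ^ 3 ≤ y := le_trans (pow_le_pow_right₀ hlogx1 (by norm_num)) hy4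
  have hylog5 : Real.log y ≤ Real.log x ^ (1 / 5 : ℝ) :=
    hylog.trans (Real.rpow_le_rpow_of_exponent_le hlogx1 (by norm_num))
  set α : ℝ := saddlePoint x y with hα
  have hα35 : 3 / 5 ≤ α := h35 x y hx₃₅ hy3' hyx
  have hα1 : α ≤ 1 := (hlt1 x y hx₁ hy3' hyx hylog).le
  have hq0 : q ≠ 0 := NeZero.ne q
  have he₀0 : (0 : ℝ) < e₀ := by exact_mod_cast he₀
  have hX : 0 < x / e₀ := div_pos hx0 he₀0
  have hlogy0 : 0 < Real.log y := by linarith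
  have hy1 : (1 : ℝ) < y := by
    by_contra h0; push Not at h0
    have := Real.log_nonpos (Nat.cast_nonneg y) h0; linarith
  -- `q ≤ Λ ≤ y^θ ≤ y`, so `q` is `y`-smooth
  have hqθ : (q : ℝ) ≤ (y : ℝ) ^ θ := hqΛ.trans hΛθ
  have hqy : (q : ℝ) ≤ y := by
    refine hqθ.trans ?_
    calc (y : ℝ) ^ θ ≤ (y : ℝ) ^ (1 : ℝ) := Real.rpow_le_rpow_of_exponent_le hy1.le (by linarith)
      _ = y := Real.rpow_one _
  have hqS : q ∈ Nat.smoothNumbers (y + 1) := by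
    rw [Nat.mem_smoothNumbers']
    intro p hp hpq
    have : p ≤ q := Nat.le_of_dvd (NeZero.pos q) hpq
    have : (p : ℝ) ≤ y := le_trans (by exact_mod_cast this) hqy
    exact_mod_cast (show (p : ℝ) < y + 1 by linarith)
  -- ### split off the principal character
  rw [arcSum_eq_sum_char (x / e₀) y ha lam, ← Finset.add_sum_erase _ _ (Finset.mem_univ (1 : DirichletCharacter ℂ q))]
  have hunit : IsUnit ((a : ℕ) : ZMod q) := (ZMod.isUnit_iff_coprime a q).mpr ha
  have h1a : (1 : DirichletCharacter ℂ q)⁻¹ ((a : ℕ) : ZMod q) = 1 := by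
    rw [inv_one]; exact MulChar.one_apply hunit
  rw [h1a, one_mul, mul_add]
  set Mx : ℝ := x ^ α * smoothZeta α y / Real.sqrt (2 * Real.pi * saddlePhi₂ α y) with hMx
  set P : ℂ := ((q.totient : ℂ))⁻¹ * charTwistSum (x / e₀) y (1 : DirichletCharacter ℂ q) lam with hPdef
  set main : ℂ := ((((e₀ : ℝ) ^ (-α) * Mx : ℝ)) : ℂ) * twistMellin lam α * (localG α q : ℂ) with hmain
  set NP : ℂ := ((q.totient : ℂ))⁻¹ * ∑ χ ∈ (Finset.univ : Finset (DirichletCharacter ℂ q)).erase 1,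
      χ⁻¹ ((a : ℕ) : ZMod q) * charTwistSum (x / e₀) y χ lam with hNP
  have hprin : ‖P - main‖ ≤ (ε + Real.exp (-66)) * localH α q * ((e₀ : ℝ) ^ (-α) * Mx) / (1 + |lam|) :=
    hP x y hx₀P hy4 hylog5 Λ hΛ1 hΛ8 e₀ he₀ q hqS hqL lam hlam
  -- ### the non-principal characters
  set B : ℝ := (q.totient : ℝ) * Real.sqrt q * (q.divisors.card : ℝ) *
      (((x / e₀) ^ α * smoothZeta α y / (2 * π)) * decayNu y θ α lam) with hB
  have hπ := Real.pi_pos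
  have hζ : 0 < smoothZeta α y := smoothZeta_pos (by linarith)
  have hν0 := decayNu_nonneg y θ α lam
  have hB0 : 0 ≤ B := by positivity
  have hterm : ∀ χ ∈ (Finset.univ : Finset (DirichletCharacter ℂ q)).erase 1,
      ‖χ⁻¹ ((a : ℕ) : ZMod q) * charTwistSum (x / e₀) y χ lam‖ ≤ B := by
    intro χ hχ
    have hχ1 : χ ≠ 1 := Finset.ne_of_mem_erase hχ
    rw [norm_mul]
    calc ‖χ⁻¹ ((a : ℕ) : ZMod q)‖ * ‖charTwistSum (x / e₀) y χ lam‖ ≤ 1 * B :=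
          mul_le_mul (DirichletCharacter.norm_le_one _ _)
            (norm_charTwistSum_nonprincipal_le hgood hδ₀ hδ₀' hθ0 hθ hy25 hy40 hyq hy3 hα35 hα1 hX hqθ χ hχ1 lam)
            (norm_nonneg _) zero_le_one
      _ = B := one_mul B
  have hφpos : (0 : ℝ) < (q.totient : ℝ) := by exact_mod_cast Nat.totient_pos.mpr (NeZero.pos q)
  have hNPle : ‖NP‖ ≤ B := by
    rw [hNP, norm_mul, norm_inv, Complex.norm_natCast]
    calc (q.totient : ℝ)⁻¹ * ‖∑ χ ∈ (Finset.univ : Finset (DirichletCharacter ℂ q)).erase 1,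
          χ⁻¹ ((a : ℕ) : ZMod q) * charTwistSum (x / e₀) y χ lam‖
        ≤ (q.totient : ℝ)⁻¹ * ∑ χ ∈ (Finset.univ : Finset (DirichletCharacter ℂ q)).erase 1, B := by
          apply mul_le_mul_of_nonneg_left ((norm_sum_le _ _).trans (Finset.sum_le_sum hterm)) (by positivity)
      _ ≤ (q.totient : ℝ)⁻¹ * ∑ _χ ∈ (Finset.univ : Finset (DirichletCharacter ℂ q)), B := by
          apply mul_le_mul_of_nonneg_left _ (by positivity)
          exact Finset.sum_le_sum_of_subset_of_nonneg (Finset.erase_subset _ _) fun _ _ _ => hB0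
      _ = B := by
          rw [Finset.sum_const, nsmul_eq_mul, card_univ_dirichletCharacter q]
          field_simp
  -- ### crude bounds `φ(q) ≤ q`, `d(q) ≤ q`, `(x/e₀)^α ≤ x^α`, `ν(λ) ≤ ν(Λ)`
  have hBle : B ≤ (q : ℝ) ^ 2 * Real.sqrt q * ((x ^ α * smoothZeta α y / (2 * π)) * decayNu y θ α Λ) := by
    rw [hB]
    have h1 : (q.totient : ℝ) ≤ q := by exact_mod_cast Nat.totient_le q
    have h2 : (q.divisors.card : ℝ) ≤ q := by exact_mod_cast Nat.card_divisors_le_self q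
    have h3 : (x / e₀) ^ α ≤ x ^ α := Real.rpow_le_rpow hX.le (div_le_self hx0.le (by exact_mod_cast he₀)) (by linarith)
    have h4 : decayNu y θ α lam ≤ decayNu y θ α Λ := decayNu_mono hlam
    have hxα : 0 ≤ (x / e₀) ^ α := Real.rpow_nonneg hX.le _
    calc (q.totient : ℝ) * Real.sqrt q * (q.divisors.card : ℝ) * (((x / e₀) ^ α * smoothZeta α y / (2 * π)) * decayNu y θ α lam)
        ≤ (q : ℝ) * Real.sqrt q * q * ((x ^ α * smoothZeta α y / (2 * π)) * decayNu y θ α Λ) := by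
          gcongr
      _ = _ := by ring
  calc ‖P + NP - main‖ = ‖(P - main) + NP‖ := by ring_nf
    _ ≤ ‖P - main‖ + ‖NP‖ := norm_add_le _ _
    _ ≤ _ := add_le_add hprin (hNPle.trans hBle)

end Endgame

end Literature.NumberTheory.Sieve

end
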